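import Literature.MathematicalPhysics.QuantumFieldTheory.Volkov2017.WholeSimplexIntegral
import HarnessLib

/-!
# The law of Volkov's generation algorithm (PRD 96 §III.C "The algorithm", Generation parts 1–2): a sector with probability `genProb`, then `t_l = r_l^{1/Deg}`, `y_l = t₂⋯t_l`, `z` by (21) — the output is distributed with the density `g = g₀/Σ_{a∈Λ} W(Λ∖{a})` on the simplex — PROVED

independent recomputation; certified where stated, statistical where stated; no new-physics claim.

CITATION HEADER (venture `QEDPrecision`, cell `pub-qed`, track TROPICAL seat V3a = `pub-qed-trop-v3-lit-1` gen 13; VALUE-FREE: change-of-variables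
identities in the symbols `Deg(s) > 0`; no constant, nothing per graph, per word or per Set V family). Fourth file of the chain
`FastSamplingTable.lean` (the table `W`, (23), (24) and the SECTOR law `genProb` of Generation part 1) → `SectorIntegral.lean` / `SumToMaxLemma.lean`
(one sector: the value `1/∏Deg` and the `δ`-simplex ↔ affine chart ↔ Hepp unit box passages) → `WholeSimplexIntegral.lean` (the whole simplex:
sector partition of the `δ`-chart, `∫ g₀ = Σ_a W(Λ∖{a})`, `∫ g = 1`, sector mass under `g` = `genProb`; listed there as NOT typed: "the law of the
point-generation step («Generation part 2»)"). This file types that law: the printed algorithm's output point is distributed with density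
`g = g₀/Σ_{a∈Λ} W(Λ∖{a})` w.r.t. the `δ(Σz − 1)` measure on `{z > 0}` (read in the chart `z₁ = 1 − Σ_{l≥2} z_l`). Serves
`tropical/view/V3-VOLKOV-DEGREES.md` §A A.2.3 / A.19 / A.29 / A.31 ("Still prose on the sampler side: the pushforward law of «Generation part 2»").

Source [Volkov2017]: S. Volkov, Phys. Rev. D 96, 096018 (2017) = arXiv:1705.05800v4 (e-print `amm4_mc_arxiv.tex` held on the cell's HOME under
`data/lit/sources/.cache/1705.05800/`, sha256 3d5fd6a7…; §III.C = arXiv PDF p.17–18; equation numbers counted from the numbered `equation`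
environments, LaTeX labels given), VERBATIM:
* §III.C (tex l.956–971, after eq. (22) `eq_subst_yt`): "Lemma 1 is also useful for generating a point inside the given sector. By this lemma,
  the generation of z₁,…,z_n in S_{j₁,…,j_n} is equivanent [sic] to the generation of 1 ≥ y₂ ≥ y₃ ≥ … ≥ y_n with the probability density
  C·∏_{l=2}^{n}(y_l/y_{l−1})^{Deg({j_l,…,j_n})}/(y₂·…·y_n), where the substitution (21) is applied. Applying (22) we obtain that the generation
  is equivalent to the independent generation of t_l, 0 ≤ t_l ≤ 1, 2 ≤ l ≤ n with the probability densities C · t^{Deg({j_l,…,j_n})−1}."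
* §III.C "The algorithm" (tex l.984–1008): "Initialization part. 1. Calculate W(s) for all s ⊆ Λ using (23). 2. Calculate P[s,a] for all
  s ⊆ Λ, s ≠ ∅, a ∈ s using (24). Generation part. 1. Generation of a sector. for l := 1 to n do put j_l = a with the probability
  P[Λ∖{j₁,…,j_{l−1}}, a]; 2. Generation of a point. Generate r₂,…,r_n ∈ [0;1] using the uniform distribution. Put
  t_l = r_l^{1/Deg({j_l,…,j_n})}, 2 ≤ l ≤ n. Put y₁ = 1, y_l = t₂…t_l, 2 ≤ l ≤ n. Calculate z₁,…,z_n using (21) [z_{j_l} = y_l/(1+y₂+…+y_n)]."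
* §III.B (tex l.594–599): "The probability density function is defined by g(z₁,…,z_n) = g₀(z₁,…,z_n)/∫_{z₁,…,z_n>0} g₀(z₁,…,z_n) δ(z₁+…+z_n−1)
  dz₁…dz_n."  [and §III.C (tex l.973–982): that integral "equals Σ_{a∈Λ} W(Λ∖{a})" = `FastSamplingTable.totalW`, typed in `WholeSimplexIntegral`.]
* §III.A "Importance Sampling" (tex l.491–511): "For integration of a function f(x) = f(x₁,…,x_n) over Ω using Monte-Carlo approach with the
  probability density function g(x), ∫_Ω g(x) dx = 1, we take randomly N samples x₁,…,x_N with the distribution g and approximate the needed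
  integral by (1/N) Σ_{j=1}^{N} f(x_j)/g(x_j). The standard deviation of this value is (13) `eq_sigma` σ = √(V(f,g)/N), where
  V(f,g) = ∫_Ω f(x)²/g(x) dx − (∫_Ω f(x) dx)², see [mc_james]."

What is typed (all PROVED; Mathlib + the tree's `Volkov2017/WholeSimplexIntegral` and what it imports). Conventions = `SumToMaxLemma` /
`WholeSimplexIntegral`: `n = m + 2`, lines `0,…,n−1`, `ℝⁿ = Fin (m + 2) → ℝ`, chart `x = (z₂,…,z_n)` with `z = simplexPoint x = (1 − Σ x, x)`; the
uniform variables `r` and the sector variables `t` live on the unit box `Borinsky2020.heppUnitBox m = (0,1]^{n−1}` (= `[0;1]^{n−1}` up to a null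
set), INDEXED INCREASINGLY as in the tree: `t_k` here is Volkov's `t_{n−k}` and carries `D (rev k) = Deg` of the tail set of size `k + 1`
(`SumToMaxLemma.g0Fund_cons_one`); a LAW is stated as the identity of `∫ φ(output) d(input law)` with `∫ φ · density` for every
Banach-valued test function `φ` (no integrability needed where none is stated: both sides are then junk together).
* §1 "Put t_l = r_l^{1/Deg}": `rpowVec E β = (β_k^{E_k})_k` (def; the inverse substitution `r = t^{Deg}`), `rpowVec_inv_rpowVec` /
  `rpowVec_rpowVec_inv`, `rpowVecDeriv` (def, diagonal) with `hasFDerivAt_rpowVec`, **`det_rpowVecDeriv = ∏_k E_k β_k^{E_k−1}`**, `injOn_rpowVec`,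
  `image_rpowVec_heppUnitBox` (the unit box onto itself), and **`setIntegral_heppUnitBox_comp_rpowVec_inv`**:
  `∫_{r∈(0,1]^{n−1}} ψ(r^{1/E}) dr = ∫_{t∈(0,1]^{n−1}} (∏_k E_k t_k^{E_k−1}) • ψ(t) dt` — "the independent generation of t_l … with the probability
  densities C · t^{Deg−1}" realised by the printed substitution (`C = Deg`).
* §2 THE SECTOR `S_{1,…,n}`: `pointFromSectorVars t = maxToSum (heppMap t ∘ rev)` (def: "y₁ = 1, y_l = t₂…t_l" then (21), as the chart point),
  `genPoint D r` (def: the whole of Generation part 2 for `S_{1,…,n}`), `simplexPoint_pointFromSectorVars` (the simplex point IS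
  `(1,y)/(1+Σy)` = eq. (21)), and **`integral_comp_genPoint`**: `∫_{r} φ(genPoint D r) dr = (∏_i D_i) • ∫_{x ∈ simplexSectorChart} g0Fund D (z x) • φ x dx`
  — the generated point has the sector-normalised density `g₀ · ∏_l Deg = g₀/[(19)]` on the sector (assembly: `SumToMaxLemma.setIntegral_simplexSectorChart_eq_heppUnitBox`
  = Lemma 1 + (21) + (22) for an arbitrary integrand, `g0Fund_smul` (degree `−n`) against the chart factor `(1+Σa)^{−n}`,
  `SectorIntegral.jacobian_mul_sectorDensity_heppMap` (Hepp's Jacobian turns `g₀` into `∏ t^{Deg−1}`), then §1).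
* §3 THE SECTOR `S_σ`: `genPointSector Deg σ r = Φ_{σ⁻¹}(genPoint (tailDeg Deg σ) r)` (def: relabel the generated coordinates to the lines
  `j_l = σ(l−1)`, `WholeSimplexIntegral.chartPerm`) and **`integral_comp_genPointSector`**: `∫_r φ(genPointSector Deg σ r) dr =
  (∏_i tailDeg Deg σ i) • ∫_{chartSector σ} g0Simplex Deg (z x) • φ x dx` (§2 transported by the measure-preserving `Φ_{σ⁻¹}`,
  `WholeSimplexIntegral.setIntegral_chartSector_eq`, with `g0Simplex` = (16) of the sector there, `g0Simplex_eq_of_antitone'`).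
* §4 THE WHOLE ALGORITHM: `genProb_mul_prod_tailDeg` (`genProb(σ) · ∏ tailDeg = 1/totalW`: the loop's law (24) telescoped,
  `FastSamplingTable.genProb_eq`, against `sectorIntegral = 1/∏Deg`) and the headline **`sum_genProb_smul_integral_comp_genPointSector`**: for
  `Deg > 0` on the non-empty proper subsets and every `φ` with `g₀ φ` integrable on the simplex,
  `Σ_σ genProb Deg Λ [σ 0,…,σ(n−1)] • ∫_r φ(genPointSector Deg σ r) dr = ∫_{simplexChart} (g0Simplex Deg (z x)/totalW Deg Λ) • φ x dx` — choosing the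
  sector by Generation part 1 and the point by Generation part 2 produces a point distributed with the density `g = g₀/Σ_{a∈Λ} W(Λ∖{a})`
  w.r.t. `δ(Σz − 1) dz` on `{z > 0}`: the printed algorithm samples the printed density.
* §5 THE ESTIMATOR OF §III.A UNDER THIS LAW: `samplingDensity Deg x = g0Simplex Deg (z x)/totalW` (def: `g` in the chart), `samplingDensity_pos`,
  `integral_samplingDensity = 1`; **`sum_genProb_smul_integral_weight`**: for every `f` integrable on the simplex (Banach-valued) the weight
  `f/g` of one draw has mean `Σ_σ genProb(σ) • ∫_r g(x_σ(r))⁻¹ • f(x_σ(r)) dr = ∫_{simplexChart} f` — the printed estimator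
  `(1/N) Σ f(x_j)/g(x_j)` is UNBIASED for the printed sampler; **`sum_genProb_mul_integral_weight_sq`**: for real `f` with `f²/g` integrable,
  `E[(f/g)²] = ∫_{simplexChart} f²/g` — the first integral of the printed `V(f,g)`, so `V(f,g)` of eq. (13) IS the variance of one draw of
  THIS algorithm and "V(f,g) is infinite" (case 3 of §III.A) is non-integrability of `f²/g` over the simplex.
NOT typed here: the statement as an identity of MEASURES (`Measure.map` of the product of the sector law and Lebesgue measure on the box = the
`withDensity` measure) — the test-function form above is its integral characterisation; the uniform law on `[0;1]` vs `(0,1]` (a null set);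
floating-point / pseudo-randomness matters of an implementation; anything about `Deg` beyond positivity; `n = 1`.
-/

namespace Literature.MathematicalPhysics.QuantumFieldTheory.Volkov2017

open MeasureTheory Set Real
open Borinsky2020

variable {m : ℕ}

/-! ### §1 "Put `t_l = r_l^{1/Deg({j_l,…,j_n})}`": the coordinatewise power map on the unit box and its Jacobian -/

/-- The coordinatewise power map `β ↦ (β_k^{E_k})_k` (the INVERSE of the generation step `t = r^{1/Deg}`: `r = t^{Deg}`).
[cite: Volkov2017, §III.C "The algorithm", Generation part 2 ("Put t_l = r_l^{1/Deg({j_l,…,j_n})}", tex l.1003–1004)] -/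
noncomputable def rpowVec (E : Fin (m + 1) → ℝ) (β : Fin (m + 1) → ℝ) : Fin (m + 1) → ℝ := fun k => β k ^ E k

/-- Unfolding. [cite: Volkov2017, §III.C Generation part 2] -/
@[simp] theorem rpowVec_apply (E β : Fin (m + 1) → ℝ) (k : Fin (m + 1)) : rpowVec E β k = β k ^ E k := rfl

/-- `(β^{E})^{1/E} = β` coordinatewise on the positive orthant (`E_k ≠ 0`). [cite: Volkov2017, §III.C Generation part 2] -/
theorem rpowVec_inv_rpowVec {E : Fin (m + 1) → ℝ} (hE : ∀ k, E k ≠ 0) {β : Fin (m + 1) → ℝ} (hβ : ∀ k, 0 ≤ β k) :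
    rpowVec (fun k => (E k)⁻¹) (rpowVec E β) = β := by
  funext k
  simp only [rpowVec_apply]
  exact Real.rpow_rpow_inv (hβ k) (hE k)

/-- `(r^{1/E})^{E} = r` coordinatewise on the positive orthant (`E_k ≠ 0`). [cite: Volkov2017, §III.C Generation part 2] -/
theorem rpowVec_rpowVec_inv {E : Fin (m + 1) → ℝ} (hE : ∀ k, E k ≠ 0) {r : Fin (m + 1) → ℝ} (hr : ∀ k, 0 ≤ r k) :
    rpowVec E (rpowVec (fun k => (E k)⁻¹) r) = r := by
  funext k
  simp only [rpowVec_apply]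
  exact Real.rpow_inv_rpow (hr k) (hE k)

/-- The derivative of the power map at a positive point: the diagonal map `v ↦ (E_k β_k^{E_k − 1} v_k)_k`.
[cite: Volkov2017, §III.C Generation part 2 (the substitution t = r^{1/Deg})] -/
noncomputable def rpowVecDeriv (E β : Fin (m + 1) → ℝ) : (Fin (m + 1) → ℝ) →L[ℝ] (Fin (m + 1) → ℝ) :=
  ContinuousLinearMap.pi fun k => (E k * β k ^ (E k - 1)) • ContinuousLinearMap.proj k

/-- `rpowVec E` is differentiable at positive points with the diagonal derivative. [cite: Volkov2017, §III.C Generation part 2] -/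
theorem hasFDerivAt_rpowVec (E : Fin (m + 1) → ℝ) {β : Fin (m + 1) → ℝ} (hβ : ∀ k, 0 < β k) :
    HasFDerivAt (rpowVec E) (rpowVecDeriv E β) β := by
  refine hasFDerivAt_pi.mpr fun k => ?_
  have h := (hasFDerivAt_apply (𝕜 := ℝ) k β).rpow_const (p := E k) (Or.inl (hβ k).ne')
  simpa [rpowVecDeriv] using h

/-- The Jacobian determinant of the power map: `∏_k E_k β_k^{E_k − 1}` (a diagonal matrix).
[cite: Volkov2017, §III.C Generation part 2 (t = r^{1/Deg} ⇔ r = t^{Deg}, dr = Deg·t^{Deg−1} dt)] -/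
theorem det_rpowVecDeriv (E β : Fin (m + 1) → ℝ) : (rpowVecDeriv E β).det = ∏ k, E k * β k ^ (E k - 1) := by
  have hM : LinearMap.toMatrix' (rpowVecDeriv E β : (Fin (m + 1) → ℝ) →ₗ[ℝ] (Fin (m + 1) → ℝ)) =
      Matrix.diagonal fun k => E k * β k ^ (E k - 1) := by
    ext i j
    rw [LinearMap.toMatrix'_apply]
    simp only [ContinuousLinearMap.coe_coe, rpowVecDeriv, ContinuousLinearMap.pi_apply,
      _root_.smul_apply, ContinuousLinearMap.proj_apply, Pi.single_apply, smul_eq_mul, mul_ite, mul_one,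
      mul_zero, Matrix.diagonal_apply]
  rw [ContinuousLinearMap.det, ← LinearMap.det_toMatrix', hM, Matrix.det_diagonal]

/-- On the positive orthant with `E > 0` the Jacobian is positive. [cite: Volkov2017, §III.C Generation part 2] -/
theorem det_rpowVecDeriv_pos {E : Fin (m + 1) → ℝ} (hE : ∀ k, 0 < E k) {β : Fin (m + 1) → ℝ} (hβ : ∀ k, 0 < β k) :
    0 < (rpowVecDeriv E β).det := by
  rw [det_rpowVecDeriv]
  exact Finset.prod_pos fun k _ => mul_pos (hE k) (Real.rpow_pos_of_pos (hβ k) _)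

/-- The power map is injective on the positive orthant (`E_k ≠ 0`). [cite: Volkov2017, §III.C Generation part 2] -/
theorem injOn_rpowVec {E : Fin (m + 1) → ℝ} (hE : ∀ k, E k ≠ 0) : InjOn (rpowVec E) {β | ∀ k, 0 < β k} := by
  intro β hβ β' hβ' h
  have h2 := congrArg (rpowVec fun k => (E k)⁻¹) h
  rwa [rpowVec_inv_rpowVec hE fun k => (hβ k).le, rpowVec_inv_rpowVec hE fun k => (hβ' k).le] at h2

/-- The power map with positive exponents maps the unit box `(0,1]^{n−1}` onto itself ("r_l ∈ [0;1]" ↔ "0 ≤ t_l ≤ 1").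
[cite: Volkov2017, §III.C Generation part 2 ("Generate r₂,…,r_n ∈ [0;1] … Put t_l = r_l^{1/Deg}")] -/
theorem image_rpowVec_heppUnitBox {E : Fin (m + 1) → ℝ} (hE : ∀ k, 0 < E k) :
    rpowVec E '' heppUnitBox m = heppUnitBox m := by
  ext r
  constructor
  · rintro ⟨β, hβ, rfl⟩ k
    exact ⟨Real.rpow_pos_of_pos (hβ k).1 _, Real.rpow_le_one (hβ k).1.le (hβ k).2 (hE k).le⟩
  · intro hr
    refine ⟨rpowVec (fun k => (E k)⁻¹) r, fun k => ⟨Real.rpow_pos_of_pos (hr k).1 _,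
      Real.rpow_le_one (hr k).1.le (hr k).2 (inv_nonneg.mpr (hE k).le)⟩, ?_⟩
    exact rpowVec_rpowVec_inv (fun k => (hE k).ne') fun k => (hr k).1.le

/-- **"Put `t_l = r_l^{1/Deg}`" realises the densities `Deg · t^{Deg−1}`**: for uniform `r` on the unit box and EVERY `ψ` (Banach-valued,
no integrability needed), `∫_{r ∈ (0,1]^{n−1}} ψ(r^{1/E}) dr = ∫_{t ∈ (0,1]^{n−1}} (∏_k E_k t_k^{E_k − 1}) • ψ(t) dt` — "the generation is
equivalent to the independent generation of t_l, 0 ≤ t_l ≤ 1, 2 ≤ l ≤ n with the probability densities C · t^{Deg({j_l,…,j_n})−1}"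
(`C = Deg`). [cite: Volkov2017, §III.C (display before "For calculating the probability density", tex l.965–971) and Generation part 2
(tex l.1001–1004)] -/
theorem setIntegral_heppUnitBox_comp_rpowVec_inv {F : Type*} [NormedAddCommGroup F] [NormedSpace ℝ F]
    {E : Fin (m + 1) → ℝ} (hE : ∀ k, 0 < E k) (ψ : (Fin (m + 1) → ℝ) → F) :
    ∫ r in heppUnitBox m, ψ (rpowVec (fun k => (E k)⁻¹) r) =
      ∫ t in heppUnitBox m, (∏ k, E k * t k ^ (E k - 1)) • ψ t := by
  have himg := image_rpowVec_heppUnitBox (m := m) hE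
  calc ∫ r in heppUnitBox m, ψ (rpowVec (fun k => (E k)⁻¹) r)
      = ∫ r in rpowVec E '' heppUnitBox m, ψ (rpowVec (fun k => (E k)⁻¹) r) := by rw [himg]
    _ = ∫ t in heppUnitBox m, |(rpowVecDeriv E t).det| • ψ (rpowVec (fun k => (E k)⁻¹) (rpowVec E t)) :=
        integral_image_eq_integral_abs_det_fderiv_smul volume measurableSet_heppUnitBox
          (fun β hβ => (hasFDerivAt_rpowVec E fun k => (hβ k).1).hasFDerivWithinAt)
          ((injOn_rpowVec fun k => (hE k).ne').mono fun β hβ k => (hβ k).1)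
          (fun r => ψ (rpowVec (fun k => (E k)⁻¹) r))
    _ = ∫ t in heppUnitBox m, (∏ k, E k * t k ^ (E k - 1)) • ψ t := by
        refine setIntegral_congr_fun measurableSet_heppUnitBox fun t ht => ?_
        rw [abs_of_pos (det_rpowVecDeriv_pos hE fun k => (ht k).1), det_rpowVecDeriv,
          rpowVec_inv_rpowVec (fun k => (hE k).ne') fun k => (ht k).1.le]

/-! ### §2 Generation part 2 for the sector `S_{1,…,n}`: "`y₁ = 1, y_l = t₂⋯t_l`" and (21) — the output has density
`(∏_l Deg) · g₀` on the sector -/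

/-- **The point of Generation part 2 in the chart, for the sector `S_{1,…,n}` and sector variables `t`**: `y = (1, t₂, t₂t₃, …)` (Volkov's
"y₁ = 1, y_l = t₂…t_l" = `Borinsky2020.heppMap` read in decreasing order) then `z = y/(1 + y₂ + … + y_n)` (eq. (21)), returned as the
chart point `x = (z₂,…,z_n)` = `SumToMaxLemma.maxToSum y`. [cite: Volkov2017, §III.C Generation part 2 ("Put y₁ = 1, y_l = t₂…t_l,
2 ≤ l ≤ n. Calculate z₁,…,z_n using (21).", tex l.1005–1006)] -/
noncomputable def pointFromSectorVars (t : Fin (m + 1) → ℝ) : Fin (m + 1) → ℝ := maxToSum (heppMap t ∘ Fin.rev)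

/-- **The whole of Generation part 2 for `S_{1,…,n}`** as a map of the uniform variables `r`: `t = r^{1/D}` (the variable `β_k = t_{n−k}`
carrying `D (rev k) = Deg` of the tail set of size `k + 1`, as in `SumToMaxLemma.g0Fund_cons_one`), then `pointFromSectorVars`.
[cite: Volkov2017, §III.C Generation part 2 (tex l.999–1006)] -/
noncomputable def genPoint (D : Fin (m + 1) → ℝ) (r : Fin (m + 1) → ℝ) : Fin (m + 1) → ℝ :=
  pointFromSectorVars (rpowVec (fun k => (D (Fin.rev k))⁻¹) r)

/-- The simplex point of the generated chart point is `(1, y)/(1 + Σ y)` — eq. (21) — with `y = heppMap t ∘ rev`.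
[cite: Volkov2017, §III.C eq. (21) `eq_subst_zy`] -/
theorem simplexPoint_pointFromSectorVars (t : Fin (m + 1) → ℝ) (ht : ∀ k, 0 < t k) :
    simplexPoint (pointFromSectorVars t) =
      (1 + ∑ i, heppMap t i)⁻¹ • (Fin.cons 1 (heppMap t ∘ Fin.rev) : Fin (m + 2) → ℝ) := by
  have hpos : 0 < 1 + ∑ j, (heppMap t ∘ Fin.rev) j :=
    add_pos_of_pos_of_nonneg one_pos (Finset.sum_nonneg fun j _ => (heppMap_pos ht _).le)
  rw [pointFromSectorVars, simplexPoint_eq, cons_one_sub_sum_maxToSum hpos.ne', sum_comp_rev]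

/-- **THE LAW OF GENERATION PART 2 ON `S_{1,…,n}`**: for uniform `r ∈ (0,1]^{n−1}` the generated chart point `x = genPoint D r` satisfies,
for EVERY test function `φ` (Banach-valued), `∫ φ(genPoint D r) dr = (∏_i D_i) • ∫_{x ∈ S_{1,…,n}} g₀(z(x)) • φ(x) dx` — i.e. its law is the
sector-normalised density (16), `g₀ · ∏_l Deg({j_l,…,j_n}) = g₀/[(19)]` on the sector: "By this lemma, the generation of z₁,…,z_n in
S_{j₁,…,j_n} is equivalent to the generation of 1 ≥ y₂ ≥ … ≥ y_n with the probability density C·∏(y_l/y_{l−1})^{Deg}/(y₂…y_n) …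
Applying (22) we obtain that the generation is equivalent to the independent generation of t_l … with the probability densities
C · t^{Deg−1}". Assembly: `SumToMaxLemma.setIntegral_simplexSectorChart_eq_heppUnitBox` (Lemma 1 + (21) + (22) for an arbitrary
integrand), `g0Fund`'s homogeneity and `SectorIntegral.jacobian_mul_sectorDensity_heppMap` (the Jacobians turn `g₀` into
`∏ t^{Deg−1}`), then §1. [cite: Volkov2017, §III.C (tex l.956–971) and "The algorithm", Generation part 2 (tex l.999–1006)] -/
theorem integral_comp_genPoint {F : Type*} [NormedAddCommGroup F] [NormedSpace ℝ F]
    (D : Fin (m + 1) → ℝ) (hD : ∀ i, 0 < D i) (φ : (Fin (m + 1) → ℝ) → F) :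
    ∫ r in heppUnitBox m, φ (genPoint D r) =
      (∏ i, D i) • ∫ x in simplexSectorChart m, g0Fund D (simplexPoint x) • φ x := by
  -- Step 1 (§1): uniform r ↦ t = r^{1/D∘rev} with densities D(rev k) t_k^{D(rev k) − 1}
  have h1 := setIntegral_heppUnitBox_comp_rpowVec_inv (E := fun k => D (Fin.rev k)) (fun k => hD _)
    (fun t => φ (pointFromSectorVars t))
  rw [show (fun r => φ (genPoint D r)) = fun r => φ (pointFromSectorVars (rpowVec (fun k => (D (Fin.rev k))⁻¹) r)) from rfl,
    h1]
  -- Step 2 (Lemma 1 + (21) + (22)): the sector integral in sector variables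
  have h2 := setIntegral_simplexSectorChart_eq_heppUnitBox (m := m)
    (fun z : Fin (m + 2) → ℝ => g0Fund D z • φ (Fin.tail z))
  have h2' : ∫ x in simplexSectorChart m, g0Fund D (simplexPoint x) • φ x =
      ∫ β in heppUnitBox m, (∏ k : Fin (m + 1), β k ^ (D (Fin.rev k) - 1)) • φ (pointFromSectorVars β) := by
    simp only [simplexPoint_eq] at h2 ⊢
    have htail : ∀ x : Fin (m + 1) → ℝ, Fin.tail (Fin.cons (1 - ∑ i, x i) x : Fin (m + 2) → ℝ) = x :=
      fun x => Fin.tail_cons _ _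
    simp only [htail] at h2
    rw [h2]
    refine setIntegral_congr_fun measurableSet_heppUnitBox fun β hβ => ?_
    have hβpos : ∀ j, 0 < β j := fun j => (hβ j).1
    have hS : 0 < 1 + ∑ i, heppMap β i :=
      add_pos_of_pos_of_nonneg one_pos (Finset.sum_nonneg fun i _ => (heppMap_pos hβpos i).le)
    have hc : (1 + ∑ i, heppMap β i)⁻¹ ≠ 0 := inv_ne_zero hS.ne'
    -- homogeneity of g₀ and the tail of the rescaled point
    have htail' : Fin.tail ((1 + ∑ i, heppMap β i)⁻¹ • (Fin.cons 1 (heppMap β ∘ Fin.rev) : Fin (m + 2) → ℝ)) =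
        pointFromSectorVars β := by
      funext i
      simp only [Fin.tail, Pi.smul_apply, Fin.cons_succ, smul_eq_mul, pointFromSectorVars, maxToSum_apply, sum_comp_rev]
      rw [div_eq_inv_mul]
    rw [g0Fund_smul D hc, htail', g0Fund_cons_one, smul_smul, smul_smul]
    congr 1
    have hcomp : (heppMap β ∘ Fin.rev) ∘ Fin.rev = heppMap β := by
      funext i
      simp
    have hj := jacobian_mul_sectorDensity_heppMap hβpos (D ∘ Fin.rev)
    simp only [Function.comp_apply] at hj
    rw [hcomp, ← hj, inv_pow, div_inv_eq_mul, mul_assoc]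
    congr 1
    rw [mul_comm, mul_assoc, mul_inv_cancel₀ (pow_ne_zero _ hS.ne'), mul_one]
  rw [h2', ← integral_smul]
  refine setIntegral_congr_fun measurableSet_heppUnitBox fun t ht => ?_
  rw [smul_smul]
  congr 1
  rw [Finset.prod_mul_distrib]
  congr 1
  exact Fintype.prod_equiv Fin.revPerm _ _ fun k => rfl

/-! ### §3 Generation part 2 for a general sector `S_{j₁,…,j_n}`: relabel back by `Φ_{σ⁻¹}` -/

/-- **Generation part 2 for the sector `σ = (j₁,…,j_n)`**: run it for `S_{1,…,n}` with the sector's tail-set exponents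
`tailDeg Deg σ` and relabel the lines back, `z = w ∘ σ⁻¹` ("z_{j_l} = y_l/(1+y₂+…+y_n)" assigns the `l`-th generated coordinate to the
line `j_l`), i.e. apply `Φ_{σ⁻¹}` in the chart. [cite: Volkov2017, §III.C Generation part 2 with eq. (21) `eq_subst_zy` (tex l.999–1006)] -/
noncomputable def genPointSector (Deg : Finset (Fin (m + 2)) → ℝ) (σ : Equiv.Perm (Fin (m + 2))) (r : Fin (m + 1) → ℝ) :
    Fin (m + 1) → ℝ :=
  chartPerm σ⁻¹ (genPoint (tailDeg Deg σ) r)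

/-- **THE LAW OF GENERATION PART 2 ON THE SECTOR `S_σ`**: for uniform `r`, `∫ φ(genPointSector Deg σ r) dr =
(∏_i Deg(tail set)) • ∫_{chartSector σ} g₀(z(x)) • φ(x) dx` with `g₀ = g0Simplex` (= (16) of the sector there) — the generated point has
the sector-normalised density `g₀/[(19)]` on `S_σ` (§2 transported by the measure-preserving `Φ_{σ⁻¹}`, `WholeSimplexIntegral` §2–§4).
[cite: Volkov2017, §III.C (tex l.956–971: "the generation of z₁,…,z_n in S_{j₁,…,j_n} is equivalent to …") and Generation part 2
(tex l.999–1006)] -/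
theorem integral_comp_genPointSector {F : Type*} [NormedAddCommGroup F] [NormedSpace ℝ F] {Deg : Finset (Fin (m + 2)) → ℝ}
    (hDeg : ∀ s : Finset (Fin (m + 2)), s.Nonempty → s ⊂ Finset.univ → 0 < Deg s) (σ : Equiv.Perm (Fin (m + 2)))
    (φ : (Fin (m + 1) → ℝ) → F) :
    ∫ r in heppUnitBox m, φ (genPointSector Deg σ r) =
      (∏ i, tailDeg Deg σ i) • ∫ x in chartSector σ, g0Simplex Deg (simplexPoint x) • φ x := by
  have h1 := integral_comp_genPoint (tailDeg Deg σ) (tailDeg_pos hDeg σ) (fun x => φ (chartPerm σ⁻¹ x))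
  simp only [genPointSector]
  rw [h1]
  congr 1
  have h2 := setIntegral_chartSector_eq (m := m) σ (fun z : Fin (m + 2) → ℝ => g0Simplex Deg z • φ (Fin.tail z))
  simp only [tail_simplexPoint] at h2
  rw [h2]
  refine setIntegral_congr_fun measurableSet_simplexSectorChart fun y hy => ?_
  rw [← chartSector_one] at hy
  obtain ⟨hpos, hanti⟩ := mem_chartSector_iff.mp hy
  have hu : (simplexPoint y ∘ ⇑σ⁻¹) ∘ ⇑σ = simplexPoint y := by
    ext j
    simp
  have hanti' : Antitone ((simplexPoint y ∘ ⇑σ⁻¹) ∘ ⇑σ) := by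
    rw [hu]
    simpa using hanti
  show g0Fund (tailDeg Deg σ) (simplexPoint y) • φ (chartPerm σ⁻¹ y) =
    g0Simplex Deg (simplexPoint y ∘ ⇑σ⁻¹) • φ (Fin.tail (simplexPoint y ∘ ⇑σ⁻¹))
  rw [g0Simplex_eq_of_antitone' (z := simplexPoint y ∘ ⇑σ⁻¹) (fun j => hpos _) hanti', hu]
  rfl

/-! ### §4 The whole algorithm: sector by Generation part 1 (law `genProb`), point by Generation part 2 — the output has density
`g = g₀/Σ_{a∈Λ} W(Λ∖{a})` on the simplex -/

/-- Generation part 1 weights times part 2's normaliser: `genProb(σ) · ∏_i Deg(tail set) = 1/Σ_{a∈Λ} W(Λ∖{a})` (the sector law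
(24) telescoped, `FastSamplingTable.genProb_eq`, against `sectorIntegral = 1/∏Deg`). [cite: Volkov2017, §III.C eqs. (23)–(24) and
Generation part 1 (tex l.993–998)] -/
theorem genProb_mul_prod_tailDeg {Deg : Finset (Fin (m + 2)) → ℝ}
    (hDeg : ∀ s : Finset (Fin (m + 2)), s.Nonempty → s ⊂ Finset.univ → 0 < Deg s) (σ : Equiv.Perm (Fin (m + 2))) :
    genProb Deg Finset.univ (List.ofFn ⇑σ) * ∏ i, tailDeg Deg σ i = (totalW Deg Finset.univ)⁻¹ := by
  have htot : totalW Deg Finset.univ ≠ 0 := (totalW_pos Finset.univ_nonempty hDeg).ne'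
  have hprod : ∏ i, tailDeg Deg σ i ≠ 0 := (Finset.prod_pos fun i _ => tailDeg_pos hDeg σ i).ne'
  have hmem := ofFn_mem_orderings σ
  rw [List.ofFn_succ] at hmem
  rw [List.ofFn_succ, genProb_eq hDeg hmem, ← List.ofFn_succ, sectorIntegral_ofFn, Finset.prod_inv_distrib]
  field_simp

/-- **THE LAW OF VOLKOV'S ALGORITHM ("The algorithm", PRD 96 §III.C) ON THE WHOLE SIMPLEX.** Choose the sector `σ` by Generation part 1
(probability `genProb Deg Λ [σ 0,…,σ (n−1)]`, the loop with the step law (24)) and the point by Generation part 2 (uniform `r`, `t = r^{1/Deg}`,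
`y`, (21)); then for every test function `φ` with `g₀ φ` integrable on the simplex,
`Σ_σ genProb(σ) • ∫ φ(genPointSector Deg σ r) dr = ∫_{z>0} [g₀(z)/Σ_{a∈Λ} W(Λ∖{a})] φ δ(Σz − 1) dz` — the output is distributed with the
density `g = g₀/∫g₀` of §III.B ("The probability density function is defined by g = g₀/∫ g₀ δ(Σz−1) dz") whose normaliser is the printed
`Σ_{a∈Λ} W(Λ∖{a})` (`WholeSimplexIntegral.integral_simplexChart_g0Simplex`). [cite: Volkov2017, §III.B (tex l.594–599) and §III.C "The
algorithm" (tex l.984–1008)] -/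
theorem sum_genProb_smul_integral_comp_genPointSector {F : Type*} [NormedAddCommGroup F] [NormedSpace ℝ F]
    {Deg : Finset (Fin (m + 2)) → ℝ} (hDeg : ∀ s : Finset (Fin (m + 2)), s.Nonempty → s ⊂ Finset.univ → 0 < Deg s)
    (φ : (Fin (m + 1) → ℝ) → F) (hφ : IntegrableOn (fun x => g0Simplex Deg (simplexPoint x) • φ x) (simplexChart m)) :
    ∑ σ : Equiv.Perm (Fin (m + 2)), genProb Deg Finset.univ (List.ofFn ⇑σ) • ∫ r in heppUnitBox m, φ (genPointSector Deg σ r) =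
      ∫ x in simplexChart m, (g0Simplex Deg (simplexPoint x) / totalW Deg Finset.univ) • φ x := by
  have hσ : ∀ σ : Equiv.Perm (Fin (m + 2)),
      genProb Deg Finset.univ (List.ofFn ⇑σ) • ∫ r in heppUnitBox m, φ (genPointSector Deg σ r) =
        (totalW Deg Finset.univ)⁻¹ • ∫ x in chartSector σ, g0Simplex Deg (simplexPoint x) • φ x := fun σ => by
    rw [integral_comp_genPointSector hDeg σ φ, smul_smul, genProb_mul_prod_tailDeg hDeg σ]
  simp_rw [hσ]
  rw [← Finset.smul_sum, ← integral_simplexChart_eq_sum (integrableOn_simplexChart_iff.mp hφ), ← integral_smul]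
  refine setIntegral_congr_fun measurableSet_simplexChart fun x _ => ?_
  rw [smul_smul, div_eq_inv_mul]

/-! ### §5 The importance-sampling estimator of §III.A under the algorithm's law: one draw of `f/g` has mean `∫ f` and second
moment `∫ f²/g` — the two integrals of "σ = √(V(f,g)/N), V(f,g) = ∫ f²/g − (∫ f)²" -/

/-- **The sampling density in the chart**: `g(x) = g₀(z(x))/Σ_{a∈Λ} W(Λ∖{a})` ("g = g₀/∫ g₀ δ(Σz−1) dz" with the printed value of the
normaliser). [cite: Volkov2017, §III.B (tex l.594–599) and §III.C (tex l.973–982)] -/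
noncomputable def samplingDensity (Deg : Finset (Fin (m + 2)) → ℝ) (x : Fin (m + 1) → ℝ) : ℝ :=
  g0Simplex Deg (simplexPoint x) / totalW Deg Finset.univ

/-- Unfolding. [cite: Volkov2017, §III.B (tex l.594–599)] -/
theorem samplingDensity_eq (Deg : Finset (Fin (m + 2)) → ℝ) (x : Fin (m + 1) → ℝ) :
    samplingDensity Deg x = g0Simplex Deg (simplexPoint x) / totalW Deg Finset.univ := rfl

/-- `g > 0` on the open simplex. [cite: Volkov2017, §III.B eq. (16) ("Deg(s) > 0") with (tex l.594–599)] -/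
theorem samplingDensity_pos {Deg : Finset (Fin (m + 2)) → ℝ}
    (hDeg : ∀ s : Finset (Fin (m + 2)), s.Nonempty → s ⊂ Finset.univ → 0 < Deg s) {x : Fin (m + 1) → ℝ}
    (hx : x ∈ simplexChart m) : 0 < samplingDensity Deg x :=
  div_pos (g0Simplex_pos Deg hx) (totalW_pos Finset.univ_nonempty hDeg)

/-- `g` integrates to `1` over the simplex (restated from `WholeSimplexIntegral`). [cite: Volkov2017, §III.B (tex l.565–569: "g must satisfy
the condition ∫ g δ(Σz−1) dz = 1")] -/
theorem integral_samplingDensity {Deg : Finset (Fin (m + 2)) → ℝ}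
    (hDeg : ∀ s : Finset (Fin (m + 2)), s.Nonempty → s ⊂ Finset.univ → 0 < Deg s) :
    ∫ x in simplexChart m, samplingDensity Deg x = 1 :=
  integral_simplexChart_g0Simplex_div_totalW hDeg

/-- **THE MEAN OF ONE DRAW: `E[f(x)/g(x)] = ∫ f`** — under the algorithm's law the importance-sampling weight `f/g` of §III.A
("we take randomly N samples x₁,…,x_N with the distribution g and approximate the needed integral by (1/N) Σ_j f(x_j)/g(x_j)") has
expectation exactly the wanted integral `∫_{z>0} f δ(Σz−1) dz` (read in the chart), for every `f` integrable on the simplex: the printed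
estimator is unbiased for the printed sampler. [cite: Volkov2017, §III.A (tex l.491–500) with §III.C "The algorithm" (tex l.984–1008)] -/
theorem sum_genProb_smul_integral_weight {F : Type*} [NormedAddCommGroup F] [NormedSpace ℝ F]
    {Deg : Finset (Fin (m + 2)) → ℝ} (hDeg : ∀ s : Finset (Fin (m + 2)), s.Nonempty → s ⊂ Finset.univ → 0 < Deg s)
    (f : (Fin (m + 1) → ℝ) → F) (hf : IntegrableOn f (simplexChart m)) :
    ∑ σ : Equiv.Perm (Fin (m + 2)), genProb Deg Finset.univ (List.ofFn ⇑σ) •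
        ∫ r in heppUnitBox m, (samplingDensity Deg (genPointSector Deg σ r))⁻¹ • f (genPointSector Deg σ r) =
      ∫ x in simplexChart m, f x := by
  have hT : totalW Deg Finset.univ ≠ 0 := (totalW_pos Finset.univ_nonempty hDeg).ne'
  have hint : IntegrableOn (fun x => g0Simplex Deg (simplexPoint x) • ((samplingDensity Deg x)⁻¹ • f x)) (simplexChart m) := by
    have h1 : IntegrableOn (totalW Deg Finset.univ • f) (simplexChart m) := hf.smul _
    refine h1.congr_fun (fun x hx => ?_) measurableSet_simplexChart
    have hg : g0Simplex Deg (simplexPoint x) ≠ 0 := (g0Simplex_pos Deg hx).ne'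
    show totalW Deg Finset.univ • f x = g0Simplex Deg (simplexPoint x) • ((samplingDensity Deg x)⁻¹ • f x)
    rw [smul_smul, samplingDensity_eq, inv_div, ← mul_div_assoc, mul_div_cancel_left₀ _ hg]
  rw [sum_genProb_smul_integral_comp_genPointSector hDeg (fun x => (samplingDensity Deg x)⁻¹ • f x) hint]
  refine setIntegral_congr_fun measurableSet_simplexChart fun x hx => ?_
  show samplingDensity Deg x • ((samplingDensity Deg x)⁻¹ • f x) = f x
  rw [smul_smul, mul_inv_cancel₀ (samplingDensity_pos hDeg hx).ne', one_smul]

/-- **THE SECOND MOMENT OF ONE DRAW: `E[(f(x)/g(x))²] = ∫ f²/g`** — the first integral of the printed "V(f,g) = ∫_Ω f(x)²/g(x) dx −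
(∫_Ω f(x) dx)²" in "σ = √(V(f,g)/N)", eq. (13) `eq_sigma`; so `V(f,g)` IS the variance of one draw of the printed algorithm's weight, and
"V(f,g) is infinite" (case 3) is the statement that `f²/g` is not integrable over the simplex. (Hypothesis: `f²/g` integrable — the
finite case; for every real `f`.) [cite: Volkov2017, §III.A eq. (13) `eq_sigma` and the display after it (tex l.501–511), with §III.C
"The algorithm"] -/
theorem sum_genProb_mul_integral_weight_sq {Deg : Finset (Fin (m + 2)) → ℝ}
    (hDeg : ∀ s : Finset (Fin (m + 2)), s.Nonempty → s ⊂ Finset.univ → 0 < Deg s) (f : (Fin (m + 1) → ℝ) → ℝ)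
    (hf : IntegrableOn (fun x => f x ^ 2 / samplingDensity Deg x) (simplexChart m)) :
    ∑ σ : Equiv.Perm (Fin (m + 2)), genProb Deg Finset.univ (List.ofFn ⇑σ) *
        ∫ r in heppUnitBox m, (f (genPointSector Deg σ r) / samplingDensity Deg (genPointSector Deg σ r)) ^ 2 =
      ∫ x in simplexChart m, f x ^ 2 / samplingDensity Deg x := by
  have hT : totalW Deg Finset.univ ≠ 0 := (totalW_pos Finset.univ_nonempty hDeg).ne'
  have hint : IntegrableOn (fun x => g0Simplex Deg (simplexPoint x) • (f x / samplingDensity Deg x) ^ 2) (simplexChart m) := by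
    have h1 : IntegrableOn (fun x => totalW Deg Finset.univ * (f x ^ 2 / samplingDensity Deg x)) (simplexChart m) :=
      hf.const_mul _
    refine h1.congr_fun (fun x hx => ?_) measurableSet_simplexChart
    have hg : (samplingDensity Deg x) ≠ 0 := (samplingDensity_pos hDeg hx).ne'
    have hg0 : g0Simplex Deg (simplexPoint x) = totalW Deg Finset.univ * samplingDensity Deg x := by
      rw [samplingDensity_eq, mul_div_cancel₀ _ hT]
    show totalW Deg Finset.univ * (f x ^ 2 / samplingDensity Deg x) = g0Simplex Deg (simplexPoint x) • (f x / samplingDensity Deg x) ^ 2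
    rw [smul_eq_mul, hg0]
    field_simp
  have h := sum_genProb_smul_integral_comp_genPointSector hDeg (fun x => (f x / samplingDensity Deg x) ^ 2) hint
  simp only [smul_eq_mul] at h
  rw [h]
  refine setIntegral_congr_fun measurableSet_simplexChart fun x hx => ?_
  have hg : (samplingDensity Deg x) ≠ 0 := (samplingDensity_pos hDeg hx).ne'
  show g0Simplex Deg (simplexPoint x) / totalW Deg Finset.univ * (f x / samplingDensity Deg x) ^ 2 = f x ^ 2 / samplingDensity Deg x
  rw [← samplingDensity_eq]
  field_simp

end Literature.MathematicalPhysics.QuantumFieldTheory.Volkov2017
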